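/-
Copyright (c) 2026 the pub-hodgecm-mathlib formalisation cell (harness21).  Prover seat hodgecm-mathlib-K2E3-p12 (g8), Track B ∕ K2-LIT, h413 = `stmt-HodgeConjecture-24833`,
line `K2_E1_TraceFormulaBeta`, campaign «R8₂-sph EXHAUSTION», ruling (124) of the dealer K2E1-plan (g6): the PAYER of the letter `hweight` of ★ p859654
`K2E1PseudoEisensteinInnerProductCMTwo.pseudoEisenstein_inner_product_cm_two_of_letters` (K2E1-p12 (g0)) — unfolding + adjunction + constant term for `⟨θ_f, θ_{f′}⟩_X` on `U(1,1)_{L∕L⁺}`.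
-/
import Summits.HodgeConjecture.HodgeConjecture.Theorems.K2E1PseudoEisensteinInnerProductCMTwoFinal   -- ★ p859681 (this seat): §1 `setLIntegral_inv_mul_inv_mul_enorm_lt_top`; transitively ★ D0 p859615 (θ_f toolkit), ★ (δ)₂, ★ hAVG, ★ R3, ★ C
import HarnessLib

/-!
# R8₂-sph f3-sph — `K2E1PseudoEisensteinWeightCMTwo`: THE WEIGHT-LEVEL UNFOLDING OF `⟨θ_f, θ_{f′}⟩_X` ON `U(1,1)_{L∕L⁺}` — the letter `hweight` of ★ p859654 PAID
# `∫_X θ_f·conj θ_{f′} dμ = c_μ·∫_{G(𝔸)} β(g)•( f(Hg)·conj( f′(Hg) + (ν𝓕)⁻¹•∫_{N(𝔸)} f′(H(w₀vg)) dν ) ) dν_G`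

Track B ∕ K2-LIT, crux h413 = `stmt-HodgeConjecture-24833`, route of record `HCCMUnconditional`; cell `hodgecm-mathlib`, squad K2, ENGINE E1.  THEOREMS ONLY (no `def`, no `instance`,
no `notation`, no named-fact hypothesis, no `sorry`); lane `--supports stmt-HodgeConjecture-24833 --as helper` (count-neutral).  Convention of record = LEFT (`θ_f := eisensteinSeriesU
(fun g => f (borelHeight g))`, `quotFun F [g] = F(g̃⁻¹)`, `borelConstantTerm ν 𝓕 φ g = (ν𝓕)⁻¹∫_𝓕 φ(ug) dν`).
THE MATHEMATICS ([MoeglinWaldspurger1995, II.1.3, II.1.7–II.1.8]; [Garrett2018, §1.8, §1.10–§1.11]).  For `f, f′ ∈ C_c((0,∞))` (continuity suffices here) and a covering weight `β` of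
`B(F)♯`: (1) `θ_{f′}` is Borel, left-`G(L⁺)`-invariant and BOUNDED (★ D0 `exists_bound_eisensteinSeriesU_comp_borelHeight_cm_two` — reduction theory + cusp vanishing), and the `L¹` letter
`∫⁻ β‖f∘H‖ dν_G < ∞` holds (★ (δ)₂ `[0,∞]` half + ★ C's radial push-forward + ★ Final `setLIntegral_inv_mul_inv_mul_enorm_lt_top`; the auxiliary Haar data `μ_K, ν_I, 𝓕_I` enter ONLY here),
so ★ D0 `exists_integral_quotFun_eisensteinSeriesU_mul_conj_eq` unfolds `⟨θ_f, θ_{f′}⟩_X = c_μ·∫ β•((f∘H)·conj θ_{f′}) dν_G` (Weil's `c_μ > 0`, uniform); (2) the average is free ★ hAVG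
`integral_wt_smul_mul_conj_eq_mul_conj_borelConstantTerm_two`: `θ_{f′} ↦ θ_{f′,B}`; (3) ★ R3 `borelConstantTerm_eisensteinSeriesU_two` with its Godement `hfin` ★ D0 `hfin_comp_borelHeight_cm_two`:
`θ_{f′,B}(g) = f′(Hg) + (ν𝓕)⁻¹•∫_{N(𝔸)} f′(H(w₀ v g)) dν(v)`.  HENCE **`exists_integral_quotFun_mul_conj_eq_weight_cm_two`** — the conclusion is ★ p859654's binder `hweight` VERBATIM
(`cμ : ℂ` there is `(cμ : ℝ) : ℂ` here, `0 < cμ`), plus the integrability of the pairing; with ★ p859681 (the letter-free head) this closes BOTH roads to MW II.2.1 at `U(1,1)`.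
HONEST LABEL: HC_CM is proved only modulo the 7 printed citations (2 remaining named inputs: hLiu418 = `stmt-HodgeConjecture-24832`, h413 = `stmt-HodgeConjecture-24833`) until rung 0
closes; this file asserts no named fact, closes no socket; count-neutral; letter-free (structural measure data only).

## References
* [MoeglinWaldspurger1995] C. Mœglin, J.-L. Waldspurger, *Spectral decomposition and Eisenstein series* (1995), II.1.3, II.1.7–II.1.8, II.2.1.
* [Garrett2018] P. Garrett, *Modern Analysis of Automorphic Forms by Example* (2018), §1.8, §1.10–§1.11.
-/

set_option autoImplicit false
set_option linter.dupNamespace false  -- the mandated namespace repeats the summit's segment (`HodgeConjecture.HodgeConjecture`)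

noncomputable section

open MeasureTheory Measure Set Filter Topology Complex NumberField IsDedekindDomain MulAction
open scoped Real NNReal ENNReal ComplexConjugate Pointwise
open Literature.MeasureTheory.Group Literature.NumberTheory
open Literature.NumberTheory.Automorphic Literature.NumberTheory.Automorphic.UnitaryGroup AdelicGroupData
open Summit.HodgeConjecture.HodgeConjecture.Cruxes.H413.K2E1BorelEisensteinU
open Summit.HodgeConjecture.HodgeConjecture.Cruxes.H413.K2E1IdeleClassRadialIntegralCM (setLIntegral_inv_ideleNorm_mul_comp_eq)
open Summit.HodgeConjecture.HodgeConjecture.Cruxes.H413.K2E1PseudoEisensteinRadialCMTwo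
open Summit.HodgeConjecture.HodgeConjecture.Cruxes.H413.K2E1PseudoEisensteinInnerProductCMTwoFinal (setLIntegral_inv_mul_inv_mul_enorm_lt_top)
open Summit.HodgeConjecture.HodgeConjecture.Cruxes.H413.K2E1EisensteinPairingUnfoldedWeightU2 (exists_integral_weight_smul_eq_mul_setIntegral_ideleClass_two)
open Summit.HodgeConjecture.HodgeConjecture.Cruxes.H413.K2E1BorelWeightAverage (integral_wt_smul_mul_conj_eq_mul_conj_borelConstantTerm_two)
open Summit.HodgeConjecture.HodgeConjecture.Cruxes.H413.K2E1BorelParabolicIntegralU2 (borelHeight_coe_eq_ideleNorm_diagUnit)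
open Summit.HodgeConjecture.HodgeConjecture.Cruxes.H413.K2E1EisensteinSeriesLeftRight (borelConstantTerm_eisensteinSeriesU_two)
open Summit.HodgeConjecture.HodgeConjecture.Cruxes.H413.K2E1UnipotentHaarNormalisationU2 (isInvInvariant_of_isHaarMeasure_two)

namespace Summit.HodgeConjecture.HodgeConjecture.Cruxes.H413.K2E1PseudoEisensteinWeightCMTwo

variable (L : Type) [Field L] [NumberField L] [IsCMField L]
variable [MeasurableSpace (quasiSplit (↥(maximalRealSubfield L)) L (IsCMField.complexConj L) 2).Adelic] [BorelSpace (quasiSplit (↥(maximalRealSubfield L)) L (IsCMField.complexConj L) 2).Adelic]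
variable [MeasurableSpace (AdeleRing (𝓞 L) L)ˣ] [BorelSpace (AdeleRing (𝓞 L) L)ˣ]

/-- **THE `L¹` LETTER `∫⁻ β·‖f∘H‖ dν_G < ∞`** for `f ∈ C_c((0,∞))` and any covering weight `β` of `B(F)♯` — ★ (δ)₂ `[0,∞]` (`K_U`-average of `‖f∘H‖` along `t·K_U` = `μ_K(K_U)·‖f(‖d₀t‖)‖`,
`H(tk) = ‖d₀t‖`), ★ C's `ℝ≥0∞` radial push-forward, and ★ `setLIntegral_inv_mul_inv_mul_enorm_lt_top`; the Haar data `μ_K, ν_I, 𝓕_I` are auxiliary. [cite: MoeglinWaldspurger1995, II.1.3]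
[cite: Garrett2018, §1.10–§1.11] -/
theorem lintegral_weight_mul_enorm_comp_borelHeight_lt_top
    (νG : Measure (quasiSplit (↥(maximalRealSubfield L)) L (IsCMField.complexConj L) 2).Adelic) [νG.IsHaarMeasure]
    (μK : Measure ((standardMaximalCompactGL 2 L).comap (adelicVal (↥(maximalRealSubfield L)) L (IsCMField.complexConj L) 2 ((StdForm.antidiagonal 2).over L)) : Subgroup (quasiSplit (↥(maximalRealSubfield L)) L (IsCMField.complexConj L) 2).Adelic))
    [μK.IsHaarMeasure]
    (νI : Measure (AdeleRing (𝓞 L) L)ˣ) [νI.IsHaarMeasure] {𝓕I : Set (AdeleRing (𝓞 L) L)ˣ} (h𝓕I : IsIdeleClassDomain L 𝓕I)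
    {β : (quasiSplit (↥(maximalRealSubfield L)) L (IsCMField.complexConj L) 2).Adelic → ℝ≥0∞}
    (hβ : IsCoveringWeight ((arithmeticBorel (↥(maximalRealSubfield L)) L (IsCMField.complexConj L) 2).map (quasiSplit (↥(maximalRealSubfield L)) L (IsCMField.complexConj L) 2).arithmeticSubgroup.subtype) β)
    {f : ℝ → ℂ} (hfc : Continuous f) (hfs : HasCompactSupport f) (hf0 : tsupport f ⊆ Ioi 0) :
    ∫⁻ g, β g * ‖f (borelHeight g : ℝ)‖ₑ ∂νG < ∞ := by
  haveI := locallyCompactSpace_adeleRing' L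
  have hc : IsCMField.complexConj L * IsCMField.complexConj L = 1 := AlgEquiv.ext fun x => IsCMField.complexConj_apply_apply L x
  have hc1 : IsCMField.complexConj L ≠ 1 := IsCMField.complexConj_ne_one L
  have hKc : IsCompact (((standardMaximalCompactGL 2 L).comap (adelicVal (↥(maximalRealSubfield L)) L (IsCMField.complexConj L) 2 ((StdForm.antidiagonal 2).over L)) :
      Subgroup (quasiSplit (↥(maximalRealSubfield L)) L (IsCMField.complexConj L) 2).Adelic) : Set (quasiSplit (↥(maximalRealSubfield L)) L (IsCMField.complexConj L) 2).Adelic) :=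
    isCompact_comap_adelicVal_standardMaximalCompactGL
  haveI : CompactSpace ((standardMaximalCompactGL 2 L).comap (adelicVal (↥(maximalRealSubfield L)) L (IsCMField.complexConj L) 2 ((StdForm.antidiagonal 2).over L)) :
      Subgroup (quasiSplit (↥(maximalRealSubfield L)) L (IsCMField.complexConj L) 2).Adelic) := isCompact_iff_compactSpace.1 hKc
  haveI : IsFiniteMeasure μK := CompactSpace.isFiniteMeasure
  obtain ⟨K, -, hKt, hδ0, -⟩ := exists_integral_weight_smul_eq_mul_setIntegral_ideleClass_two hc hc1 νG μK νI (exists_mem_borelAdelic_mul_mem_standardMaximalCompactGL_cm L (N := 2)) h𝓕I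
  have hHtk : ∀ (t : torusInBorel (↥(maximalRealSubfield L)) L (IsCMField.complexConj L) 2) (k : ((standardMaximalCompactGL 2 L).comap (adelicVal (↥(maximalRealSubfield L)) L (IsCMField.complexConj L) 2 ((StdForm.antidiagonal 2).over L)) :
      Subgroup (quasiSplit (↥(maximalRealSubfield L)) L (IsCMField.complexConj L) 2).Adelic)),
      borelHeight (((t : borelAdelic (↥(maximalRealSubfield L)) L (IsCMField.complexConj L) 2) : (quasiSplit (↥(maximalRealSubfield L)) L (IsCMField.complexConj L) 2).Adelic) * (k : (quasiSplit (↥(maximalRealSubfield L)) L (IsCMField.complexConj L) 2).Adelic)) =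
        IdeleClassGroup.ideleNorm L (diagUnit (t : borelAdelic (↥(maximalRealSubfield L)) L (IsCMField.complexConj L) 2).2 0) := fun t k => by
    rw [borelHeight_mul_of_mem_comap_standardMaximalCompactGL k.2, borelHeight_coe_eq_ideleNorm_diagUnit]
  have hIc : Continuous fun x : (AdeleRing (𝓞 L) L)ˣ => (IdeleClassGroup.ideleNorm L x : ℝ) := NNReal.continuous_coe.comp (continuous_ideleNorm_holds L)
  have hfm : Measurable fun g : (quasiSplit (↥(maximalRealSubfield L)) L (IsCMField.complexConj L) 2).Adelic => f (borelHeight g : ℝ) :=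
    (hfc.comp (NNReal.continuous_coe.comp continuous_borelHeight)).measurable
  have hL := hδ0 β hβ (fun g => ‖f (borelHeight g : ℝ)‖ₑ) hfm.enorm
    (fun n y => by simp only [borelHeight_unipotent_mul ((mem_unipotentInBorel_iff _).1 n.2)])
    (fun b hb y => by simp only [K2E1TruncatedEisensteinExplicit.borelHeight_arithmeticBorel_mul hb])
    (fun x => ‖f (IdeleClassGroup.ideleNorm L x : ℝ)‖ₑ * μK Set.univ) ((hfc.comp hIc).measurable.enorm.mul_const _)
    (fun k hk x => by simp only [map_mul, ideleNorm_principal hk, one_mul]) (fun t => by simp_rw [hHtk t]; exact lintegral_const _)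
  rw [hL, setLIntegral_inv_ideleNorm_mul_comp_eq νI h𝓕I (Gm := fun r => ‖f r‖ₑ * μK Set.univ) (hfc.measurable.enorm.mul_const _)]
  exact ENNReal.mul_lt_top hKt.lt_top (ENNReal.mul_lt_top (idelicCovolume_ne_top νI).lt_top (setLIntegral_inv_mul_inv_mul_enorm_lt_top hfc hfs hf0 (measure_ne_top μK _)))

/-- **THE LETTER `hweight` OF ★ p859654 PAID — `⟨θ_f, θ_{f′}⟩_X` UNFOLDED TO THE `B(F)`-WEIGHT LEVEL WITH THE CONSTANT TERM INSERTED.**  Data as in the letter-free head ★ p859681 (the Haar data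
`μ_K, ν_I, 𝓕_I` only certify absolute convergence).  There is ONE `c_μ > 0` (Weil's constant of ★ D0 `exists_integral_quotFun_eisensteinSeriesU_mul_conj_eq`) such that for every covering weight
`β` of `B(F)♯` and all `f, f′ ∈ C_c((0,∞))`: the pairing `x ↦ θ_f(x̃⁻¹)·conj θ_{f′}(x̃⁻¹)` is `μ`-integrable and
**`∫_X quotFun θ_f · conj (quotFun θ_{f′}) dμ = c_μ · ∫_{G(𝔸)} β(g) • ( f(H g) · conj( f′(H g) + (ν𝓕)⁻¹ • ∫_{N(𝔸)} f′(H(w₀ v g)) dν(v) ) ) dν_G(g)`** — ★ D0 unfolding (θ_{f′} bounded ★ D0) → ★ hAVG →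
★ R3 with ★ D0's Godement `hfin`. [cite: MoeglinWaldspurger1995, II.1.3 and II.1.7–II.1.8] [cite: Garrett2018, §1.8 and §1.10–§1.11] -/
theorem exists_integral_quotFun_mul_conj_eq_weight_cm_two
    (μ : Measure (quasiSplit (↥(maximalRealSubfield L)) L (IsCMField.complexConj L) 2).automorphicQuotient) [(quasiSplit (↥(maximalRealSubfield L)) L (IsCMField.complexConj L) 2).IsAutomorphicMeasure μ]
    (νG : Measure (quasiSplit (↥(maximalRealSubfield L)) L (IsCMField.complexConj L) 2).Adelic) [νG.IsHaarMeasure] [νG.IsInvInvariant]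
    (μK : Measure ((standardMaximalCompactGL 2 L).comap (adelicVal (↥(maximalRealSubfield L)) L (IsCMField.complexConj L) 2 ((StdForm.antidiagonal 2).over L)) : Subgroup (quasiSplit (↥(maximalRealSubfield L)) L (IsCMField.complexConj L) 2).Adelic))
    [μK.IsHaarMeasure]
    (νI : Measure (AdeleRing (𝓞 L) L)ˣ) [νI.IsHaarMeasure] {𝓕I : Set (AdeleRing (𝓞 L) L)ˣ} (h𝓕I : IsIdeleClassDomain L 𝓕I)
    (ν : Measure ↥(adelicUnipotent (↥(maximalRealSubfield L)) L (IsCMField.complexConj L) 2)) [ν.IsHaarMeasure]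
    {𝓕 : Set ↥(adelicUnipotent (↥(maximalRealSubfield L)) L (IsCMField.complexConj L) 2)}
    (h𝓕N : IsFundamentalDomain ↥(rationalUnipotent (↥(maximalRealSubfield L)) L (IsCMField.complexConj L) 2) 𝓕 ν) (h𝓕c : IsCompact (closure 𝓕)) (h𝓕₀ : ν 𝓕 ≠ 0) :
    ∃ cμ : ℝ, 0 < cμ ∧
      ∀ {β : (quasiSplit (↥(maximalRealSubfield L)) L (IsCMField.complexConj L) 2).Adelic → ℝ≥0∞},
        IsCoveringWeight ((arithmeticBorel (↥(maximalRealSubfield L)) L (IsCMField.complexConj L) 2).map (quasiSplit (↥(maximalRealSubfield L)) L (IsCMField.complexConj L) 2).arithmeticSubgroup.subtype) β →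
      ∀ {f f' : ℝ → ℂ}, Continuous f → HasCompactSupport f → tsupport f ⊆ Ioi 0 → Continuous f' → HasCompactSupport f' → tsupport f' ⊆ Ioi 0 →
        Integrable (fun x : (quasiSplit (↥(maximalRealSubfield L)) L (IsCMField.complexConj L) 2).automorphicQuotient =>
            (quasiSplit (↥(maximalRealSubfield L)) L (IsCMField.complexConj L) 2).quotFun (eisensteinSeriesU fun g : (quasiSplit (↥(maximalRealSubfield L)) L (IsCMField.complexConj L) 2).Adelic => f (borelHeight g : ℝ)) x *
              conj ((quasiSplit (↥(maximalRealSubfield L)) L (IsCMField.complexConj L) 2).quotFun (eisensteinSeriesU fun g : (quasiSplit (↥(maximalRealSubfield L)) L (IsCMField.complexConj L) 2).Adelic => f' (borelHeight g : ℝ)) x)) μ ∧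
        ∫ x, (quasiSplit (↥(maximalRealSubfield L)) L (IsCMField.complexConj L) 2).quotFun (eisensteinSeriesU fun g : (quasiSplit (↥(maximalRealSubfield L)) L (IsCMField.complexConj L) 2).Adelic => f (borelHeight g : ℝ)) x *
            conj ((quasiSplit (↥(maximalRealSubfield L)) L (IsCMField.complexConj L) 2).quotFun (eisensteinSeriesU fun g : (quasiSplit (↥(maximalRealSubfield L)) L (IsCMField.complexConj L) 2).Adelic => f' (borelHeight g : ℝ)) x) ∂μ =
          (cμ : ℂ) * ∫ g, (β g).toReal • (f (borelHeight g : ℝ) * conj (f' (borelHeight g : ℝ) + ((ν 𝓕).toReal⁻¹ : ℝ) •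
            ∫ v : ↥(adelicUnipotent (↥(maximalRealSubfield L)) L (IsCMField.complexConj L) 2), f' ((borelHeight ((quasiSplit (↥(maximalRealSubfield L)) L (IsCMField.complexConj L) 2).toAdelic
              (weylLongU ((IsCMField.complexConj L : L ≃ₐ[↥(maximalRealSubfield L)] L) : L →+* L) (rfl : (StdForm.antidiagonal 2).over L = (StdForm.antidiagonal 2).over L)) *
                (v : (quasiSplit (↥(maximalRealSubfield L)) L (IsCMField.complexConj L) 2).Adelic) * g)) : ℝ) ∂ν)) ∂νG := by
  haveI := locallyCompactSpace_adeleRing' L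
  haveI : ν.IsInvInvariant := isInvInvariant_of_isHaarMeasure_two ν
  have h𝓕top : ν 𝓕 ≠ ∞ := ((measure_mono subset_closure).trans_lt h𝓕c.measure_lt_top).ne
  have hc : IsCMField.complexConj L * IsCMField.complexConj L = 1 := AlgEquiv.ext fun x => IsCMField.complexConj_apply_apply L x
  have hc1 : IsCMField.complexConj L ≠ 1 := IsCMField.complexConj_ne_one L
  obtain ⟨cμ, hcμ, hunf⟩ := exists_integral_quotFun_eisensteinSeriesU_mul_conj_eq (F := ↥(maximalRealSubfield L)) (E := L) (c := IsCMField.complexConj L) (N := 2) μ νG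
  refine ⟨cμ, hcμ, fun {β} hβ {f} {f'} hfc hfs hf0 hf'c hf's hf'0 => ?_⟩
  have hHc : Continuous fun g : (quasiSplit (↥(maximalRealSubfield L)) L (IsCMField.complexConj L) 2).Adelic => (borelHeight g : ℝ) := NNReal.continuous_coe.comp continuous_borelHeight
  have hfm : Measurable fun g : (quasiSplit (↥(maximalRealSubfield L)) L (IsCMField.complexConj L) 2).Adelic => f (borelHeight g : ℝ) := (hfc.comp hHc).measurable
  have hf'm : Measurable fun g : (quasiSplit (↥(maximalRealSubfield L)) L (IsCMField.complexConj L) 2).Adelic => f' (borelHeight g : ℝ) := (hf'c.comp hHc).measurable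
  -- `θ′ = θ_{f′}`: Borel, `G(L⁺)`-invariant, bounded (★ D0)
  obtain ⟨M₁, hM₁⟩ := exists_bound_eisensteinSeriesU_comp_borelHeight_cm_two L hf'c hf's hf'0
  have hθ'm := measurable_eisensteinSeriesU_comp_borelHeight_cm_two L hf'c hf's hf'0
  have hθ'G := eisensteinSeriesU_comp_borelHeight_arithmeticSubgroup_mul (F := ↥(maximalRealSubfield L)) (E := L) (c := IsCMField.complexConj L) (N := 2) f'
  have hL1 := lintegral_weight_mul_enorm_comp_borelHeight_lt_top L νG μK νI h𝓕I hβ hfc hfs hf0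
  -- (1) unfolding, (2) the average is free
  obtain ⟨hInt, hEq⟩ := hunf hβ (f := fun g => f (borelHeight g : ℝ)) (Λ' := eisensteinSeriesU fun g : (quasiSplit (↥(maximalRealSubfield L)) L (IsCMField.complexConj L) 2).Adelic => f' (borelHeight g : ℝ))
    hfm (comp_borelHeight_arithmeticBorel_mul f) hθ'm hθ'G hM₁ hL1
  refine ⟨hInt, ?_⟩
  rw [hEq, integral_wt_smul_mul_conj_eq_mul_conj_borelConstantTerm_two hc hc1 νG ν h𝓕N h𝓕₀ h𝓕top hβ (ψ := fun g => f (borelHeight g : ℝ))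
    (Λ' := eisensteinSeriesU fun g : (quasiSplit (↥(maximalRealSubfield L)) L (IsCMField.complexConj L) 2).Adelic => f' (borelHeight g : ℝ)) hfm hθ'm
    (comp_borelHeight_unipotent_mul f) (comp_borelHeight_arithmeticBorel_mul f) (fun b _ x => hθ'G b x) (lintegral_weight_mul_conj_lt_top νG β hM₁ hL1)]
  -- (3) the constant term ★ R3 with ★ D0's Godement `hfin`
  refine congrArg _ (integral_congr_ae (ae_of_all _ fun g => ?_))
  dsimp only
  rw [borelConstantTerm_eisensteinSeriesU_two ν (f := fun x : (quasiSplit (↥(maximalRealSubfield L)) L (IsCMField.complexConj L) 2).Adelic => f' (borelHeight x : ℝ)) hf'm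
    (comp_borelHeight_unipotent_mul f') (comp_borelHeight_borelU_mul f') h𝓕N h𝓕₀ h𝓕top g (hfin_comp_borelHeight_cm_two L ν h𝓕c hf'c hf's hf'0 g)]

end Summit.HodgeConjecture.HodgeConjecture.Cruxes.H413.K2E1PseudoEisensteinWeightCMTwo

end
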